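import Literature.Combinatorics.StablePolynomials.Symmetrization
import Literature.Combinatorics.StablePolynomials.KernelForm
import Mathlib.FieldTheory.IsAlgClosed.Basic
import Mathlib.Analysis.Complex.Polynomial.Basic
import HarnessLib

/-!
# Polarization preserves stability; the Grace–Walsh–Szegő coincidence theorem for the upper half-plane

J. Borcea, P. Brändén, *The Lee–Yang and Pólya–Schur programs. I*, Invent. Math. 177 (2009), §2.2
("Decoupling schemes: polarizations of polynomials and operators"):

> Define a (linear) polarization operator `Π↑_κ : ℂ_κ[z_1,…,z_n] → ℂ^κ_MA` that associates to each
> `f` the unique polynomial `Π↑_κ(f)` such that (a) `Π↑_κ(f)` is symmetric in `{z_{ij} : 1 ≤ j ≤ κ_i}`;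
> (b) if we let `z_{ij} = z_i` […] we recover `f`. In other words
> `Π↑_κ(z^α) = binom(κ,α)⁻¹ E_{α_1}(z_{11},…,z_{1κ_1}) ⋯ E_{α_n}(z_{n1},…,z_{nκ_n})` […]. Dually we
> define a (linear) projection operator `Π↓_κ` by letting `z_{ij} ↦ z_i` […]; `Π↑_κ ∘ Π↓_κ` is the
> operator […] that symmetrizes the variables.
>
> **Proposition 2.4.** Let `f ∈ ℂ_κ[z_1,…,z_n]`. Then `f` is stable if and only if `Π↑_κ(f)` is
> stable. (Proof: "it suffices to prove the theorem for univariate polynomials […] by the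
> Grace–Walsh–Szegő theorem".)

J. Borcea, P. Brändén, *The Lee–Yang and Pólya–Schur programs. II*, Comm. Pure Appl. Math. 62
(2009), §1–§2:

> **Theorem 1.1 (Grace–Walsh–Szegő).** Let `f ∈ ℂ_{(1ⁿ)}[z_1,…,z_n]` be a symmetric polynomial, `C`
> be an open or closed circular domain, and `ξ_1,…,ξ_n ∈ C`. Suppose further that either the total
> degree of `f` equals `n` or that `C` is convex (or both). Then there exists at least one point
> `ξ ∈ C` such that `f(ξ_1,…,ξ_n) = f(ξ,…,ξ)`.

and §2, proof of Thm. 2.1 (the authors' new proof of GWS from Thm. 1.2: write the stable univariate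
restriction `h(z_n) = B ∏_j (z_n - α_j)`, form the stable multi-affine `H(w) = B ∏_j (w_j - α_j)`
and symmetrize it).

## What is here (namespace `Literature.Combinatorics.StablePolynomials`; one variable `z` polarized
into the finitely many variables `σ`, i.e. `κ = (n)`, `n = |σ|`)

* `diagonal F` — `Π↓`: the univariate polynomial `F(t,…,t)` (`MvPolynomial.aeval (fun _ => X)`);
  `eval_diagonal`, `diagonal_rename`, `diagonal_multiAffine`, `coeff_diagonal_multiAffine`,
  `diagonal_esymm` (`E_k(t,…,t) = binom(n,k) tᵏ`), `diagonal_symmetrization`.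
* **Symmetric multi-affine polynomials are determined by their diagonal** (the uniqueness in the
  definition of `Π↑`): `coeff_indicator_eq_of_forall_rename` (the coefficient of `z^S` of a symmetric
  polynomial depends only on `|S|`), `multiAffine_eq_zero_of_forall_rename_of_diagonal_eq_zero`,
  `eq_of_isMultiAffine_of_forall_rename_of_diagonal_eq`.
* `polarization σ p = Σ_k (a_k / binom(n,k)) E_k(z)` for `p = Σ_k a_k tᵏ` with `deg p ≤ n` — `Π↑`;
  symmetric, multi-affine, `diagonal_polarization` (= (b)), `polarization_eq_of_diagonal_eq` (the
  uniqueness (a)+(b)), `existsUnique_symmetric_isMultiAffine_diagonal_eq`,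
  **`symmetrization_eq_polarization_diagonal`** (`Sym = Π↑ ∘ Π↓` on multi-affine polynomials),
  `polarization_diagonal`.
* **`isUpperHalfPlaneStable_polarization_iff`** — Prop. 2.4 (univariate case, `C = H`): for
  `deg p ≤ n`, `Π↑ p` has no zero in `Hⁿ` iff `p` has no zero in `H`. The nontrivial direction is
  proved as in BB-II §2: `p = B ∏_j (t - α_j)` with `Im α_j ≤ 0` (ℂ algebraically closed), the
  multi-affine `B ∏_j (z_{ι j} - α_j)` (distinct variables `ι j`) is stable, its symmetrization is
  stable by Thm. 1.2 (a) (`IsUpperHalfPlaneStable.symmetrization`, `Symmetrization.lean`) and equals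
  `Π↑ p` by uniqueness.
* **`exists_eval_eq_eval_const_of_im_pos`** — the Grace–Walsh–Szegő coincidence theorem for the
  open upper half-plane: `f` symmetric multi-affine, `Im ξ_i > 0` ⟹ `∃ ζ`, `Im ζ > 0`,
  `f(ξ_1,…,ξ_n) = f(ζ,…,ζ)`; `exists_eval_eq_eval_const_of_im_nonneg` — the closed upper
  half-plane (by a small translation `z ↦ z - iε` clearing the finitely many roots of the diagonal);
  `exists_eval_eq_eval_const_of_im_affine_pos` / `_nonneg` — every open / closed half-plane
  `{z : Im(az + b) > 0}` / `{z : Im(az + b) ≥ 0}`, `a ≠ 0`, transported along the affine change of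
  variables `affineSubst a b : z_i ↦ a z_i + b` (BB-II Lemma 1.8 with `φ_i` affine).

Not here: discs and exteriors of discs (BB-II Lemma 1.8 / Cor. 1.7 with genuine Möbius
transformations) and the degree condition for non-convex `C`; the multivariate `Π↑_κ` (several
original variables) and Lemma 2.5 / Thm. 1.1 for general `κ` — TODO(general form).

## Mathlib / tree search

REUSED: tree `symmetrization`, `IsUpperHalfPlaneStable.symmetrization`, `eval_const_symmetrization`,
`multiAffine`, `eq_multiAffine_of_isMultiAffine`, `coeff_multiAffine_indicator`,
`multiAffine_eq_zero_iff`, `isMultiAffine_multiAffine`, `isUpperHalfPlaneStable_prod`,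
`isUpperHalfPlaneStable_C`; Mathlib `MvPolynomial.esymm`, `MvPolynomial.esymm_isSymmetric`,
`MvPolynomial.coeff_rename_mapDomain`, `Equiv.extendSubtype`, `Fintype.equivOfCardEq`,
`Polynomial.Splits.eq_prod_roots`, `IsAlgClosed.splits`, `Fin.prod_univ_fun_getElem`. Mathlib has no
Grace–Walsh–Szegő / Grace apolarity / polarization of polynomials (searched `Grace`, `Walsh`,
`apolar`, `polarization`).

## References

* J. Borcea, P. Brändén, *The Lee–Yang and Pólya–Schur programs. I. Linear operators preserving
  stability*, Invent. Math. 177 (2009) 541–569; arXiv:0809.0401: §2.2 (Π↑_κ, Π↓_κ, (a), (b);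
  Thm. 2.3 (GWS); Prop. 2.4). [BorceaBranden2009]
* J. Borcea, P. Brändén, *The Lee–Yang and Pólya–Schur programs. II. Theory of stable polynomials and
  applications*, Comm. Pure Appl. Math. 62 (2009) 1595–1631; arXiv:0809.3087: §1 Thm. 1.1 (GWS),
  Thm. 1.2; §2 Thm. 2.1 and its proof. [BorceaBranden2009II]
* D. G. Wagner, *Multivariate stable polynomials: theory and applications*, Bull. AMS 48 (2011),
  Thm. 2.12 (GWS) and §2.4 (polarization). [Wagner2011]
-/

noncomputable section

open MvPolynomial Finset

namespace Literature.Combinatorics.StablePolynomials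

variable {σ : Type*}

/-! ## §1 The diagonal restriction `Π↓ : F ↦ F(t,…,t)` -/

section Diagonal

variable {R : Type*} [CommSemiring R]

/-- **The projection `Π↓`** ("letting `z_{ij} ↦ z_i`", here all variables `↦ t`): the univariate
polynomial `F(t,…,t) ∈ R[t]`, as an `R`-algebra map. [cite: BorceaBranden2009, §2.2 (definition of
Π↓_κ)] -/
def diagonal : MvPolynomial σ R →ₐ[R] Polynomial R :=
  aeval fun _ : σ => (Polynomial.X : Polynomial R)

/-- `Π↓(z_i) = t`. [cite: BorceaBranden2009, §2.2 (definition of Π↓_κ)] -/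
@[simp] theorem diagonal_X (i : σ) : diagonal (X i : MvPolynomial σ R) = Polynomial.X :=
  aeval_X _ i

/-- `Π↓(c) = c`. [cite: BorceaBranden2009, §2.2 (definition of Π↓_κ)] -/
@[simp] theorem diagonal_C (c : R) : diagonal (C c : MvPolynomial σ R) = Polynomial.C c := by
  rw [diagonal, aeval_C, Polynomial.algebraMap_eq]

/-- `Π↓(F)(t) = F(t,…,t)`. [cite: BorceaBranden2009, §2.2 ((b): "if we let z_{ij} = z_i … we recover
f")] -/
theorem eval_diagonal (t : R) (F : MvPolynomial σ R) :
    (diagonal F).eval t = eval (fun _ : σ => t) F := by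
  rw [diagonal, ← Polynomial.coe_aeval_eq_eval, ← AlgHom.comp_apply, MvPolynomial.comp_aeval]
  simp only [Polynomial.aeval_X]
  exact congrFun (MvPolynomial.aeval_eq_eval _) F

/-- `Π↓` is blind to renamings of the variables. [cite: BorceaBranden2009, §2.2 (Π↓_κ)] -/
theorem diagonal_rename {τ : Type*} (k : σ → τ) (F : MvPolynomial σ R) :
    diagonal (rename k F) = diagonal F := by
  rw [diagonal, diagonal, aeval_rename]
  rfl

/-- `Π↓` of the coefficient form: `Π↓(Σ_S a(S) z^S) = Σ_S a(S) t^{|S|}`.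
[cite: BorceaBranden2009, §2.1–§2.2 (multi-affine `Σ_S a(S) z^S`; Π↓)] -/
theorem diagonal_multiAffine [Fintype σ] (a : Finset σ → R) :
    diagonal (multiAffine a) = ∑ S : Finset σ, Polynomial.C (a S) * Polynomial.X ^ S.card := by
  rw [multiAffine, map_sum]
  refine sum_congr rfl fun S _ => ?_
  rw [map_mul, diagonal_C, map_prod]
  simp only [diagonal_X, prod_const]

/-- The coefficients of `Π↓(Σ_S a(S) z^S)`: `[tᵏ] = Σ_{|S| = k} a(S)`.
[cite: BorceaBranden2009, §2.2 (Π↓_κ)] -/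
theorem coeff_diagonal_multiAffine [Fintype σ] (a : Finset σ → R) (k : ℕ) :
    (diagonal (multiAffine a)).coeff k = ∑ S ∈ powersetCard k univ, a S := by
  rw [diagonal_multiAffine, Polynomial.finsetSum_coeff]
  simp only [Polynomial.coeff_C_mul_X_pow]
  rw [powersetCard_eq_filter, powerset_univ, sum_filter]
  exact sum_congr rfl fun S _ => by simp only [eq_comm]

/-- `Π↓(Σ_S a(S) z^S)` has degree `≤ n`. [cite: BorceaBranden2009, §2.2 (Π↓_κ maps ℂ^κ_MA to
ℂ_κ[z])] -/
theorem natDegree_diagonal_multiAffine_le [Fintype σ] (a : Finset σ → R) :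
    (diagonal (multiAffine a)).natDegree ≤ Fintype.card σ := by
  rw [diagonal_multiAffine]
  exact Polynomial.natDegree_sum_le_of_forall_le _ _ fun S _ =>
    (Polynomial.natDegree_C_mul_X_pow_le _ _).trans (card_le_univ S)

/-- `Π↓(E_k) = binom(n,k) tᵏ` for the elementary symmetric polynomial `E_k` in `n` variables.
[cite: BorceaBranden2009, §2.2 (Π↑_κ(z^α) = binom(κ,α)⁻¹ E_α and (b))] -/
theorem diagonal_esymm [Fintype σ] (k : ℕ) :
    diagonal (esymm σ R k) =
      Polynomial.C (((Fintype.card σ).choose k : ℕ) : R) * Polynomial.X ^ k := by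
  rw [esymm, map_sum]
  simp_rw [map_prod, diagonal_X]
  rw [sum_congr rfl fun S hS => by rw [prod_const, (mem_powersetCard.1 hS).2], sum_const,
    card_powersetCard, card_univ, nsmul_eq_mul, Polynomial.C_eq_natCast]

variable [Fintype σ] [DecidableEq σ]

/-- `Π↓ ∘ Sym = Π↓`: symmetrizing does not change the diagonal.
[cite: BorceaBranden2009, §2.2 (Π↓_κ ∘ Π↑_κ = id, Π↑_κ ∘ Π↓_κ symmetrizes)] -/
theorem diagonal_symmetrization {K : Type*} [Field K] [CharZero K] (F : MvPolynomial σ K) :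
    diagonal (symmetrization F) = diagonal F := by
  rw [symmetrization_apply, map_smul, map_sum]
  simp_rw [diagonal_rename]
  rw [sum_const, card_univ, ← Nat.cast_smul_eq_nsmul K, smul_smul, inv_mul_cancel₀, one_smul]
  exact Nat.cast_ne_zero.2 Fintype.card_ne_zero

end Diagonal

/-! ## §2 Symmetric multi-affine polynomials are determined by their diagonal -/

section Uniqueness

variable [Fintype σ] [DecidableEq σ]

/-- Two subsets of the same size are exchanged by a permutation of the variables. [folklore] -/
private theorem exists_perm_image_eq {S S' : Finset σ} (h : S.card = S'.card) :
    ∃ e : Equiv.Perm σ, S.image e = S' := by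
  have hc : Fintype.card {x // x ∈ S} = Fintype.card {x // x ∈ S'} := by
    rw [Fintype.card_coe, Fintype.card_coe, h]
  let e₀ : {x // x ∈ S} ≃ {x // x ∈ S'} := Fintype.equivOfCardEq hc
  refine ⟨e₀.extendSubtype, eq_of_subset_of_card_le (fun j hj => ?_) ?_⟩
  · obtain ⟨i, hi, rfl⟩ := mem_image.1 hj
    exact e₀.extendSubtype_mem i hi
  · rw [card_image_of_injective S (Equiv.injective _), h]

variable {R : Type*} [CommSemiring R]

omit [Fintype σ] in
/-- The coefficient of `z^{π(S)}` in `π(F)` is the coefficient of `z^S` in `F`. [folklore] -/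
private theorem coeff_indicator_rename_perm (e : Equiv.Perm σ) (F : MvPolynomial σ R)
    (S : Finset σ) :
    coeff (∑ i ∈ S.image e, Finsupp.single i 1) (rename (⇑e) F) =
      coeff (∑ i ∈ S, Finsupp.single i 1) F := by
  have hmap : Finsupp.mapDomain e (∑ i ∈ S, Finsupp.single i 1 : σ →₀ ℕ) =
      ∑ i ∈ S.image e, Finsupp.single i 1 := by
    rw [Finsupp.mapDomain_finsetSum, sum_image fun i _ j _ h => e.injective h]
    simp_rw [Finsupp.mapDomain_single]
  rw [← hmap, coeff_rename_mapDomain _ e.injective]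

/-- **The coefficient of `z^S` in a symmetric polynomial depends only on `|S|`** (so a symmetric
multi-affine polynomial is a combination of the `E_k` — (a) in the definition of `Π↑`).
[cite: BorceaBranden2009, §2.2 ((a): Π↑_κ(f) is symmetric; Π↑_κ(z^α) = binom(κ,α)⁻¹ E_α)] -/
theorem coeff_indicator_eq_of_forall_rename {F : MvPolynomial σ R}
    (hF : ∀ e : Equiv.Perm σ, rename (⇑e) F = F) {S S' : Finset σ} (h : S.card = S'.card) :
    coeff (∑ i ∈ S, Finsupp.single i 1) F = coeff (∑ i ∈ S', Finsupp.single i 1) F := by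
  obtain ⟨e, he⟩ := exists_perm_image_eq h
  have := coeff_indicator_rename_perm e F S
  rw [hF e, he] at this
  exact this.symm

/-- A symmetric multi-affine coefficient form with vanishing diagonal vanishes: by symmetry the
coefficients on `k`-sets agree, and `[tᵏ] Π↓ = binom(n,k) · a(S) = 0`.
[cite: BorceaBranden2009, §2.2 (uniqueness of Π↑_κ(f): (a) and (b) determine it)] -/
theorem multiAffine_eq_zero_of_forall_rename_of_diagonal_eq_zero {a : Finset σ → ℂ}
    (hs : ∀ e : Equiv.Perm σ, rename (⇑e) (multiAffine a) = multiAffine a)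
    (hd : diagonal (multiAffine a) = 0) : multiAffine a = 0 := by
  rw [multiAffine_eq_zero_iff]
  intro S
  have hconst : ∀ S' ∈ powersetCard S.card (univ : Finset σ), a S' = a S := fun S' hS' => by
    have h := coeff_indicator_eq_of_forall_rename hs (mem_powersetCard.1 hS').2
    rwa [coeff_multiAffine_indicator, coeff_multiAffine_indicator] at h
  have hk := congrArg (fun q : Polynomial ℂ => q.coeff S.card) hd
  simp only [coeff_diagonal_multiAffine, Polynomial.coeff_zero, sum_congr rfl hconst, sum_const,
    card_powersetCard, card_univ, nsmul_eq_mul] at hk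
  exact (mul_eq_zero.1 hk).resolve_left
    (Nat.cast_ne_zero.2 (Nat.choose_pos (card_le_univ S)).ne')

omit [DecidableEq σ] in
/-- The coefficient form is additive. [cite: BorceaBranden2009, §2.1 (the linear space
ℂ_{(1ⁿ)}[z] of multi-affine polynomials `Σ_S a(S) z^S`)] -/
theorem multiAffine_sub {A : Type*} [CommRing A] (a b : Finset σ → A) :
    multiAffine a - multiAffine b = multiAffine (a - b) := by
  simp only [multiAffine, ← sum_sub_distrib, ← sub_mul, ← C_sub, Pi.sub_apply]

/-- **A symmetric multi-affine polynomial is determined by its diagonal** — the uniqueness clause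
"the unique polynomial `Π↑_κ(f)` such that (a) … symmetric … (b) … we recover `f`".
[cite: BorceaBranden2009, §2.2 (definition of Π↑_κ, uniqueness)] -/
theorem eq_of_isMultiAffine_of_forall_rename_of_diagonal_eq {F G : MvPolynomial σ ℂ}
    (hF : IsMultiAffine F) (hG : IsMultiAffine G) (hFs : ∀ e : Equiv.Perm σ, rename (⇑e) F = F)
    (hGs : ∀ e : Equiv.Perm σ, rename (⇑e) G = G) (h : diagonal F = diagonal G) : F = G := by
  have hFa := eq_multiAffine_of_isMultiAffine hF
  have hGb := eq_multiAffine_of_isMultiAffine hG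
  set a : Finset σ → ℂ := fun S => coeff (∑ i ∈ S, Finsupp.single i 1) F
  set b : Finset σ → ℂ := fun S => coeff (∑ i ∈ S, Finsupp.single i 1) G
  rw [hFa] at hFs h ⊢
  rw [hGb] at hGs h ⊢
  rw [← sub_eq_zero, multiAffine_sub]
  refine multiAffine_eq_zero_of_forall_rename_of_diagonal_eq_zero (fun e => ?_) ?_
  · rw [← multiAffine_sub, map_sub, hFs, hGs]
  · rw [← multiAffine_sub, map_sub, h, sub_self]

/-- `Π↓` of a multi-affine polynomial in `n` variables has degree `≤ n`.
[cite: BorceaBranden2009, §2.2 (Π↓_κ : ℂ^κ_MA → ℂ_κ[z])] -/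
theorem natDegree_diagonal_le {F : MvPolynomial σ ℂ} (hF : IsMultiAffine F) :
    (diagonal F).natDegree ≤ Fintype.card σ := by
  rw [eq_multiAffine_of_isMultiAffine hF]
  exact natDegree_diagonal_multiAffine_le _

end Uniqueness

/-! ## §3 The polarization `Π↑` of a univariate polynomial -/

section Polarization

variable [Fintype σ]

variable (σ) in
/-- **Polarization** of a univariate polynomial `p = Σ_k a_k tᵏ` of degree `≤ n = |σ|` into the
variables `σ`: `Π↑(p) = Σ_{k=0}^{n} a_k · binom(n,k)⁻¹ · E_k(z)` ("`Π↑_κ(z^α) = binom(κ,α)⁻¹ E_α`",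
case of one original variable, `κ = (n)`). [cite: BorceaBranden2009, §2.2 (definition of Π↑_κ)] -/
def polarization (p : Polynomial ℂ) : MvPolynomial σ ℂ :=
  ∑ k ∈ range (Fintype.card σ + 1), (p.coeff k / (((Fintype.card σ).choose k : ℕ) : ℂ)) • esymm σ ℂ k

/-- `Π↑` is linear: additive. [cite: BorceaBranden2009, §2.2 ("a (linear) polarization operator")] -/
theorem polarization_add (p q : Polynomial ℂ) :
    polarization σ (p + q) = polarization σ p + polarization σ q := by
  simp only [polarization, Polynomial.coeff_add, add_div, add_smul, sum_add_distrib]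

/-- `Π↑` is linear: homogeneous. [cite: BorceaBranden2009, §2.2 ("a (linear) polarization
operator")] -/
theorem polarization_smul (c : ℂ) (p : Polynomial ℂ) :
    polarization σ (c • p) = c • polarization σ p := by
  simp only [polarization, Polynomial.coeff_smul, smul_eq_mul, mul_div_assoc, mul_smul, smul_sum]

/-- **(a): `Π↑(p)` is symmetric.** [cite: BorceaBranden2009, §2.2 ((a))] -/
theorem rename_perm_polarization (e : Equiv.Perm σ) (p : Polynomial ℂ) :
    rename (⇑e) (polarization σ p) = polarization σ p := by
  simp only [polarization, map_sum, map_smul, esymm_isSymmetric σ ℂ _ e]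

/-- `Π↑(p)` is symmetric in Mathlib's sense. [cite: BorceaBranden2009, §2.2 ((a))] -/
theorem polarization_isSymmetric (p : Polynomial ℂ) : (polarization σ p).IsSymmetric :=
  fun e => rename_perm_polarization e p

omit [Fintype σ] in
/-- A square-free monomial `∏_{i ∈ S} z_i` is multi-affine. [cite: BorceaBranden2009, §2.1
("multi-affine if all monomials in its Taylor expansion are square-free")] -/
theorem isMultiAffine_prod_X {R : Type*} [CommSemiring R] [Nontrivial R] (S : Finset σ) :
    IsMultiAffine (∏ i ∈ S, X i : MvPolynomial σ R) := fun j => by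
  classical
  refine (degreeOf_prod_le j _ _).trans ?_
  calc ∑ i ∈ S, degreeOf j (X i : MvPolynomial σ R) ≤ ∑ i ∈ S, (if j = i then 1 else 0) :=
        sum_le_sum fun i _ => (degreeOf_X j i).le
    _ ≤ 1 := by rw [sum_ite_eq]; split_ifs <;> simp

/-- The elementary symmetric polynomials are multi-affine. [cite: BorceaBranden2009, §2.2 (E_i is the
i-th elementary symmetric polynomial, a sum of square-free monomials `x^S`)] -/
theorem isMultiAffine_esymm {R : Type*} [CommSemiring R] [Nontrivial R] (k : ℕ) :
    IsMultiAffine (esymm σ R k) := by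
  rw [esymm]
  exact IsMultiAffine.sum _ fun S _ => isMultiAffine_prod_X S

/-- `Π↑(p)` is multi-affine (`Π↑_κ` takes values in `ℂ^κ_MA`). [cite: BorceaBranden2009, §2.2
(Π↑_κ : ℂ_κ[z] → ℂ^κ_MA)] -/
theorem isMultiAffine_polarization (p : Polynomial ℂ) : IsMultiAffine (polarization σ p) :=
  IsMultiAffine.sum _ fun k _ => (isMultiAffine_esymm k).smul _

/-- **(b): `Π↓(Π↑ p) = p`** for `deg p ≤ n` ("if we let `z_{ij} = z_i` … we recover `f`";
`Π↓_κ ∘ Π↑_κ` is the identity on `ℂ_κ[z]`). [cite: BorceaBranden2009, §2.2 ((b))] -/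
theorem diagonal_polarization {p : Polynomial ℂ} (hp : p.natDegree ≤ Fintype.card σ) :
    diagonal (polarization σ p) = p := by
  rw [polarization, map_sum]
  conv_rhs => rw [p.as_sum_range' (Fintype.card σ + 1) (Nat.lt_succ_of_le hp)]
  refine sum_congr rfl fun k hk => ?_
  have hk' : k ≤ Fintype.card σ := Nat.lt_succ_iff.1 (mem_range.1 hk)
  have hne : (((Fintype.card σ).choose k : ℕ) : ℂ) ≠ 0 := Nat.cast_ne_zero.2 (Nat.choose_pos hk').ne'
  rw [map_smul, diagonal_esymm, Polynomial.smul_eq_C_mul, ← mul_assoc, ← Polynomial.C_mul,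
    div_mul_cancel₀ _ hne, Polynomial.C_mul_X_pow_eq_monomial]

/-- `Π↑(p)(t,…,t) = p(t)` for `deg p ≤ n`. [cite: BorceaBranden2009, §2.2 ((b))] -/
theorem eval_const_polarization {p : Polynomial ℂ} (hp : p.natDegree ≤ Fintype.card σ) (t : ℂ) :
    eval (fun _ : σ => t) (polarization σ p) = p.eval t := by
  rw [← eval_diagonal, diagonal_polarization hp]

variable [DecidableEq σ]

/-- **Uniqueness of `Π↑`**: a symmetric multi-affine polynomial whose diagonal is `p` (`deg p ≤ n`)
is `Π↑(p)`. [cite: BorceaBranden2009, §2.2 ("the unique polynomial Π↑_κ(f) such that (a) … (b) …")] -/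
theorem polarization_eq_of_diagonal_eq {p : Polynomial ℂ} (hp : p.natDegree ≤ Fintype.card σ)
    {G : MvPolynomial σ ℂ} (hG : IsMultiAffine G) (hGs : ∀ e : Equiv.Perm σ, rename (⇑e) G = G)
    (h : diagonal G = p) : G = polarization σ p :=
  eq_of_isMultiAffine_of_forall_rename_of_diagonal_eq hG (isMultiAffine_polarization p) hGs
    (rename_perm_polarization · p) (by rw [h, diagonal_polarization hp])

/-- **`Π↑_κ(f)` is "the unique polynomial such that (a) … (b) …"**: for `deg p ≤ n` there is exactly
one symmetric multi-affine polynomial in the variables `σ` with diagonal `p`.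
[cite: BorceaBranden2009, §2.2 (definition of Π↑_κ)] -/
theorem existsUnique_symmetric_isMultiAffine_diagonal_eq {p : Polynomial ℂ}
    (hp : p.natDegree ≤ Fintype.card σ) :
    ∃! G : MvPolynomial σ ℂ, IsMultiAffine G ∧ (∀ e : Equiv.Perm σ, rename (⇑e) G = G) ∧
      diagonal G = p :=
  ⟨polarization σ p, ⟨isMultiAffine_polarization p, (rename_perm_polarization · p),
    diagonal_polarization hp⟩, fun _ h => polarization_eq_of_diagonal_eq hp h.1 h.2.1 h.2.2⟩

/-- **`Sym = Π↑ ∘ Π↓` on multi-affine polynomials** ("`Π↑_κ ∘ Π↓_κ` is the operator on `ℂ^κ_MA`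
that […] symmetrizes all the variables"). [cite: BorceaBranden2009, §2.2 (after the definition of
Π↓_κ)] -/
theorem symmetrization_eq_polarization_diagonal {F : MvPolynomial σ ℂ} (hF : IsMultiAffine F) :
    symmetrization F = polarization σ (diagonal F) :=
  polarization_eq_of_diagonal_eq (natDegree_diagonal_le hF) hF.symmetrization
    (rename_symmetrization · F) (diagonal_symmetrization F)

/-- `Π↑(Π↓ F) = F` for a symmetric multi-affine `F`. [cite: BorceaBranden2009, §2.2 (Π↑_κ ∘ Π↓_κ
symmetrizes; identity on symmetric polynomials)] -/
theorem polarization_diagonal {F : MvPolynomial σ ℂ} (hF : IsMultiAffine F)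
    (hFs : ∀ e : Equiv.Perm σ, rename (⇑e) F = F) : polarization σ (diagonal F) = F := by
  rw [← symmetrization_eq_polarization_diagonal hF, symmetrization_eq_self hFs]

/-- `Π↑` of a constant is the constant. [cite: BorceaBranden2009, §2.2 (Π↑_κ(z^0) = E_0 = 1)] -/
theorem polarization_C (c : ℂ) : polarization σ (Polynomial.C c) = C c :=
  (polarization_eq_of_diagonal_eq (by rw [Polynomial.natDegree_C]; exact Nat.zero_le _)
    (isMultiAffine_C c) (fun e => rename_C (⇑e) c) (diagonal_C c)).symm

end Polarization

/-! ## §4 Proposition 2.4 (polarization preserves stability) and the Grace–Walsh–Szegő theorem -/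

section GraceWalshSzego

/-- A linear factor `z_i - α` with `Im α ≤ 0` is stable. [cite: BorceaBranden2009II, §2 proof of
Thm. 2.1 ("`H(w_1,…,w_{κ_n}) := B ∏_j (w_j - α_j)` is also `C_n`-stable")] -/
theorem isUpperHalfPlaneStable_X_sub_C {i : σ} {α : ℂ} (hα : α.im ≤ 0) :
    IsUpperHalfPlaneStable (X i - C α : MvPolynomial σ ℂ) := fun z hz h => by
  rw [map_sub, eval_X, eval_C, sub_eq_zero] at h
  have := hz i
  rw [h] at this
  exact absurd hα (not_le.2 this)

/-- The split multi-affine lift `B ∏_j (z_{ι(j)} - α_j)` of `B ∏_j (t - α_j)` along an injection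
`ι` of the roots into the variables is multi-affine. [cite: BorceaBranden2009II, §2 proof of
Thm. 2.1 (the polynomial `H(w) = B ∏_j (w_j - α_j)`)] -/
theorem isMultiAffine_C_mul_prod_X_sub_C {m : ℕ} {ι : Fin m → σ} (hι : Function.Injective ι)
    (B : ℂ) (α : Fin m → ℂ) :
    IsMultiAffine (C B * ∏ j : Fin m, (X (ι j) - C (α j)) : MvPolynomial σ ℂ) := by
  classical
  intro i
  refine (degreeOf_C_mul_le _ _ _).trans ((degreeOf_prod_le i _ _).trans ?_)
  calc ∑ j : Fin m, degreeOf i (X (ι j) - C (α j) : MvPolynomial σ ℂ)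
      ≤ ∑ j : Fin m, (if ι j = i then 1 else 0) := by
        refine sum_le_sum fun j _ => ?_
        rw [sub_eq_add_neg, ← C_neg]
        refine (degreeOf_add_le _ _ _).trans ?_
        rw [degreeOf_X, degreeOf_C]
        split_ifs with h1 h2 h2 <;> simp_all [eq_comm]
    _ ≤ 1 := by
        rw [← Finset.card_filter]
        refine (card_le_one.2 fun a ha b hb => hι ?_)
        rw [(mem_filter.1 ha).2, (mem_filter.1 hb).2]

variable [Fintype σ] [DecidableEq σ]

/-- **Borcea–Brändén I, Proposition 2.4 — the nontrivial direction (Grace–Walsh–Szegő)**: if the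
univariate `p` (`deg p ≤ n`) has no zero in the open upper half-plane then its polarization
`Π↑(p)` has no zero in `Hⁿ`. Proof as in BB-II §2: `p = B ∏_j (t - α_j)` with `Im α_j ≤ 0`; the
multi-affine `B ∏_j (z_{ι(j)} - α_j)` is stable, hence so is its symmetrization (Thm. 1.2 (a)),
which is `Π↑(p)` by uniqueness of the symmetric multi-affine lift.
[cite: BorceaBranden2009, §2.2 Prop. 2.4 (⇒)] [cite: BorceaBranden2009II, §2 Thm. 2.1 (proof)] -/
theorem isUpperHalfPlaneStable_polarization {p : Polynomial ℂ} (hp : p.natDegree ≤ Fintype.card σ)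
    (hst : ∀ t : ℂ, 0 < t.im → p.eval t ≠ 0) : IsUpperHalfPlaneStable (polarization σ p) := by
  have hp0 : p ≠ 0 := fun h => hst Complex.I (by simp) (by simp [h])
  have hsplit : p.Splits := IsAlgClosed.splits p
  -- the roots, as a list, and an injection of their indices into the variables
  set rs : List ℂ := p.roots.toList with hrs
  have hlen : rs.length ≤ Fintype.card σ := by
    rw [hrs, Multiset.length_toList, ← hsplit.natDegree_eq_card_roots]
    exact hp
  have hroot : ∀ j : Fin rs.length, (rs[j.1]).im ≤ 0 := fun j => by
    have hmem : rs[j.1] ∈ p.roots := Multiset.mem_toList.1 (List.getElem_mem j.2)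
    exact not_lt.1 fun him => hst _ him (Polynomial.isRoot_of_mem_roots hmem).eq_zero
  let ι : Fin rs.length → σ := fun j => (Fintype.equivFin σ).symm (Fin.castLE hlen j)
  have hι : Function.Injective ι :=
    (Fintype.equivFin σ).symm.injective.comp (Fin.castLE_injective hlen)
  -- the split multi-affine lift `Q = B ∏_j (z_{ι j} - α_j)`
  set Q : MvPolynomial σ ℂ := C p.leadingCoeff * ∏ j : Fin rs.length, (X (ι j) - C (rs[j.1])) with hQ
  have hQma : IsMultiAffine Q := isMultiAffine_C_mul_prod_X_sub_C hι _ fun j => rs[j.1]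
  have hQst : IsUpperHalfPlaneStable Q :=
    (isUpperHalfPlaneStable_C (Polynomial.leadingCoeff_ne_zero.2 hp0)).mul
      (isUpperHalfPlaneStable_prod _ fun j _ => isUpperHalfPlaneStable_X_sub_C (hroot j))
  have hdiag : diagonal Q = p := by
    rw [hQ, map_mul, diagonal_C, map_prod]
    simp only [map_sub, diagonal_X, diagonal_C]
    rw [Fin.prod_univ_fun_getElem rs (fun a : ℂ => Polynomial.X - Polynomial.C a), ← Multiset.prod_coe,
      ← Multiset.map_coe, hrs, Multiset.coe_toList]
    exact hsplit.eq_prod_roots.symm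
  rw [← hdiag, ← symmetrization_eq_polarization_diagonal hQma]
  exact hQst.symmetrization hQma

/-- **Borcea–Brändén I, Proposition 2.4 (univariate case, `C = H`)**: "Let `f ∈ ℂ_κ[z_1,…,z_n]`.
Then `f` is stable if and only if `Π↑_κ(f)` is stable" — for a univariate `p` of degree `≤ n`,
`Π↑(p) ∈ ℂ[z_σ]` has no zero in `Hⁿ` iff `p` has no zero in `H`. ("If": `Π↓` preserves stability,
i.e. restrict to the diagonal; "only if": Grace–Walsh–Szegő, `isUpperHalfPlaneStable_polarization`.)
[cite: BorceaBranden2009, §2.2 Prop. 2.4] -/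
theorem isUpperHalfPlaneStable_polarization_iff {p : Polynomial ℂ} (hp : p.natDegree ≤ Fintype.card σ) :
    IsUpperHalfPlaneStable (polarization σ p) ↔ ∀ t : ℂ, 0 < t.im → p.eval t ≠ 0 := by
  refine ⟨fun h t ht => ?_, isUpperHalfPlaneStable_polarization hp⟩
  rw [← eval_const_polarization hp t]
  exact h (fun _ => t) fun _ => ht

/-- The multivariate consequence used in BB-II §2: for a symmetric multi-affine `F` whose diagonal
`F(t,…,t)` has no zero in `H`, `F` itself has no zero in `Hⁿ`. [cite: BorceaBranden2009II, §2
proof of Thm. 2.1 ("it is enough to prove that if … `g` … is … stable then `f` … is … stable")] -/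
theorem isUpperHalfPlaneStable_of_diagonal {F : MvPolynomial σ ℂ} (hF : IsMultiAffine F)
    (hFs : ∀ e : Equiv.Perm σ, rename (⇑e) F = F)
    (hst : ∀ t : ℂ, 0 < t.im → (diagonal F).eval t ≠ 0) : IsUpperHalfPlaneStable F := by
  rw [← polarization_diagonal hF hFs]
  exact isUpperHalfPlaneStable_polarization (natDegree_diagonal_le hF) hst

/-- **The Grace–Walsh–Szegő coincidence theorem for the open upper half-plane** (BB-II Thm. 1.1 /
BB-I Thm. 2.3 with `C = H`, convex, so no degree condition): if `f ∈ ℂ[z_σ]` is symmetric and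
multi-affine and `ξ ∈ Hⁿ`, then `f(ξ_1,…,ξ_n) = f(ζ,…,ζ)` for some `ζ ∈ H`. Proof: otherwise the
diagonal of `g = f - f(ξ)` has no zero in `H`, so `g` is stable (Prop. 2.4), contradicting
`g(ξ) = 0`. [cite: BorceaBranden2009II, §1 Thm. 1.1 (C = H)] [cite: BorceaBranden2009, §2.2
Thm. 2.3] -/
theorem exists_eval_eq_eval_const_of_im_pos {f : MvPolynomial σ ℂ} (hf : IsMultiAffine f)
    (hfs : ∀ e : Equiv.Perm σ, rename (⇑e) f = f) (ξ : σ → ℂ) (hξ : ∀ i, 0 < (ξ i).im) :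
    ∃ ζ : ℂ, 0 < ζ.im ∧ eval ξ f = eval (fun _ : σ => ζ) f := by
  by_contra hne
  push Not at hne
  set g : MvPolynomial σ ℂ := f - C (eval ξ f) with hg
  have hgma : IsMultiAffine g := by
    rw [hg, sub_eq_add_neg, ← C_neg]
    exact hf.add (isMultiAffine_C _)
  have hgs : ∀ e : Equiv.Perm σ, rename (⇑e) g = g := fun e => by
    rw [hg, map_sub, hfs, rename_C]
  have hst : ∀ t : ℂ, 0 < t.im → (diagonal g).eval t ≠ 0 := fun t ht h => by
    rw [eval_diagonal, hg, map_sub, eval_C, sub_eq_zero] at h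
    exact hne t ht h.symm
  have h0 : eval ξ g = 0 := by rw [hg, map_sub, eval_C, sub_self]
  exact isUpperHalfPlaneStable_of_diagonal hgma hgs hst ξ hξ h0

/-- GWS, symmetric-polynomial form: a symmetric multi-affine `f` in Mathlib's sense
(`MvPolynomial.IsSymmetric`) takes at `ξ ∈ Hⁿ` a value it also takes on the diagonal of `Hⁿ`.
[cite: BorceaBranden2009II, §1 Thm. 1.1 (C = H)] -/
theorem _root_.MvPolynomial.IsSymmetric.exists_eval_eq_eval_const_of_im_pos {f : MvPolynomial σ ℂ}
    (hfs : f.IsSymmetric) (hf : IsMultiAffine f) (ξ : σ → ℂ) (hξ : ∀ i, 0 < (ξ i).im) :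
    ∃ ζ : ℂ, 0 < ζ.im ∧ eval ξ f = eval (fun _ : σ => ζ) f :=
  StablePolynomials.exists_eval_eq_eval_const_of_im_pos hf hfs ξ hξ

end GraceWalshSzego

/-! ## §5 Affine changes of variables `z_i ↦ a z_i + b` -/

section Affine

/-- **Affine change of variables** `z_i ↦ a z_i + b` in every variable (the linear transformations
`Φ_κ(f)(z) = ∏ (c_i z_i + d_i)^{κ_i} f(φ_1(z_1),…,φ_n(z_n))` of BB-II Lemma 1.8 for the affine Möbius
maps `φ_i(ζ) = aζ + b`, `c_i = 0`, `d_i = 1`), as a `ℂ`-algebra endomorphism (`MvPolynomial.bind₁`).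
[cite: BorceaBranden2009II, §1 Lemma 1.8 (the maps Φ_κ, affine case)] -/
def affineSubst (a b : ℂ) : MvPolynomial σ ℂ →ₐ[ℂ] MvPolynomial σ ℂ :=
  bind₁ fun i => C a * X i + C b

/-- `Φ(F)(z) = F(a z_1 + b, …, a z_n + b)`. [cite: BorceaBranden2009II, §1 Lemma 1.8] -/
theorem eval_affineSubst (a b : ℂ) (z : σ → ℂ) (F : MvPolynomial σ ℂ) :
    eval z (affineSubst a b F) = eval (fun i => a * z i + b) F := by
  rw [affineSubst, eval_bind₁]
  simp only [map_add, map_mul, eval_C, eval_X]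

/-- The affine change of variables commutes with permutations of the variables ("the partial
symmetrization operator commutes with the operator `Φ_κ`"). [cite: BorceaBranden2009II, §1 proof of
Prop. 1.3 (Φ_κ commutes with permutations of the variables)] -/
theorem rename_perm_affineSubst (e : Equiv.Perm σ) (a b : ℂ) (F : MvPolynomial σ ℂ) :
    rename (⇑e) (affineSubst a b F) = affineSubst a b (rename (⇑e) F) := by
  simp only [affineSubst, rename_bind₁, bind₁_rename, Function.comp_def, map_add, map_mul, rename_C,
    rename_X]

/-- A product of affine-linear forms in distinct variables, `∏_{i ∈ S} (a z_i + b)`, is multi-affine.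
[cite: BorceaBranden2009II, §1 Lemma 1.8 (Φ_κ preserves ℂ_κ[z], κ = (1ⁿ))] -/
theorem isMultiAffine_prod_C_mul_X_add_C (S : Finset σ) (a b : ℂ) :
    IsMultiAffine (∏ i ∈ S, (C a * X i + C b) : MvPolynomial σ ℂ) := fun j => by
  classical
  refine (degreeOf_prod_le j _ _).trans ?_
  calc ∑ i ∈ S, degreeOf j (C a * X i + C b : MvPolynomial σ ℂ) ≤ ∑ i ∈ S, (if j = i then 1 else 0) :=
        sum_le_sum fun i _ => (degreeOf_add_le _ _ _).trans (max_le
          ((degreeOf_C_mul_le _ _ _).trans (degreeOf_X j i).le) (by rw [degreeOf_C]; exact Nat.zero_le _))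
    _ ≤ 1 := by rw [sum_ite_eq]; split_ifs <;> simp

/-- The affine change of variables preserves multi-affinity (`Φ_κ : ℂ_κ[z] → ℂ_κ[z]`, `κ = (1ⁿ)`).
[cite: BorceaBranden2009II, §1 Lemma 1.8] -/
theorem IsMultiAffine.affineSubst [Fintype σ] {F : MvPolynomial σ ℂ} (hF : IsMultiAffine F)
    (a b : ℂ) : IsMultiAffine (StablePolynomials.affineSubst a b F) := by
  classical
  rw [eq_multiAffine_of_isMultiAffine hF, multiAffine, map_sum]
  refine IsMultiAffine.sum _ fun S _ => ?_
  rw [map_mul, StablePolynomials.affineSubst, bind₁_C_right, map_prod, ← smul_eq_C_mul]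
  simp only [bind₁_X_right]
  exact (isMultiAffine_prod_C_mul_X_add_C S a b).smul _

end Affine

/-! ## §6 Grace–Walsh–Szegő for closed half-planes and for arbitrary half-planes -/

section HalfPlanes

variable [Fintype σ] [DecidableEq σ]

/-- **Grace–Walsh–Szegő for the closed upper half-plane** (BB-II Thm. 1.1 with `C = H̄`, closed and
convex): `f` symmetric multi-affine, `Im ξ_i ≥ 0` ⟹ `f(ξ) = f(ζ,…,ζ)` for some `ζ` with `Im ζ ≥ 0`.
Proof: if not, every root `ρ` of the diagonal `q` of `g = f - f(ξ)` has `Im ρ < 0`, indeed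
`Im ρ < -ε` for some `ε > 0` (finitely many roots); then the diagonal `q(t - iε)` of
`g_ε(z) = g(z - iε𝟙)` has no zero in `H`, so `g_ε` is stable (Prop. 2.4), contradicting
`g_ε(ξ + iε𝟙) = g(ξ) = 0`. (The printed argument enlarges a closed `C` to an open circular domain
by compactness; for half-planes the translation does it.) [cite: BorceaBranden2009II, §1 Thm. 1.1
(C the closed upper half-plane) and proof of Thm. 1.2 for closed C] -/
theorem exists_eval_eq_eval_const_of_im_nonneg {f : MvPolynomial σ ℂ} (hf : IsMultiAffine f)
    (hfs : ∀ e : Equiv.Perm σ, rename (⇑e) f = f) (ξ : σ → ℂ) (hξ : ∀ i, 0 ≤ (ξ i).im) :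
    ∃ ζ : ℂ, 0 ≤ ζ.im ∧ eval ξ f = eval (fun _ : σ => ζ) f := by
  set g : MvPolynomial σ ℂ := f - C (eval ξ f) with hg
  have hgma : IsMultiAffine g := by
    rw [hg, sub_eq_add_neg, ← C_neg]
    exact hf.add (isMultiAffine_C _)
  have hgs : ∀ e : Equiv.Perm σ, rename (⇑e) g = g := fun e => by
    rw [hg, map_sub, hfs, rename_C]
  have hg0 : eval ξ g = 0 := by rw [hg, map_sub, eval_C, sub_self]
  have hroot : ∀ t : ℂ, (diagonal g).eval t = 0 ↔ eval ξ f = eval (fun _ : σ => t) f := fun t => by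
    rw [eval_diagonal, hg, map_sub, eval_C, sub_eq_zero, eq_comm]
  by_cases hq : diagonal g = 0
  · exact ⟨0, by simp, (hroot 0).1 (by rw [hq, Polynomial.eval_zero])⟩
  by_contra hne
  push Not at hne
  -- every root of the diagonal lies strictly below the real axis, uniformly
  have hneg : ∀ ρ ∈ (diagonal g).roots, ρ.im < 0 := fun ρ hρ => by
    by_contra h
    exact hne ρ (not_lt.1 h) ((hroot ρ).1 (Polynomial.isRoot_of_mem_roots hρ).eq_zero)
  obtain ⟨ε, hε, hερ⟩ : ∃ ε : ℝ, 0 < ε ∧ ∀ ρ ∈ (diagonal g).roots, ρ.im < -ε := by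
    by_cases hR : (diagonal g).roots.toFinset.Nonempty
    · obtain ⟨ρ₀, hρ₀, hmin⟩ := exists_min_image _ (fun ρ : ℂ => -ρ.im) hR
      have h0 := hneg ρ₀ (Multiset.mem_toFinset.1 hρ₀)
      refine ⟨-ρ₀.im / 2, by linarith, fun ρ hρ => ?_⟩
      have h1 := hmin ρ (Multiset.mem_toFinset.2 hρ)
      simp only [neg_le_neg_iff] at h1
      linarith
    · exact ⟨1, one_pos, fun ρ hρ => absurd ⟨ρ, Multiset.mem_toFinset.2 hρ⟩ hR⟩
  -- translate: `g_ε(z) = g(z - iε𝟙)`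
  set gε : MvPolynomial σ ℂ := affineSubst 1 (-((ε : ℂ) * Complex.I)) g with hgε
  have hgεma : IsMultiAffine gε := hgma.affineSubst _ _
  have hgεs : ∀ e : Equiv.Perm σ, rename (⇑e) gε = gε := fun e => by
    rw [hgε, rename_perm_affineSubst, hgs]
  have hst : ∀ t : ℂ, 0 < t.im → (diagonal gε).eval t ≠ 0 := fun t ht h0 => by
    rw [eval_diagonal, hgε, eval_affineSubst, ← eval_diagonal] at h0
    have hmem : (1 : ℂ) * t + -((ε : ℂ) * Complex.I) ∈ (diagonal g).roots :=
      (Polynomial.mem_roots hq).2 h0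
    have := hερ _ hmem
    simp only [one_mul, Complex.add_im, Complex.neg_im, Complex.mul_im, Complex.ofReal_re,
      Complex.ofReal_im, Complex.I_re, Complex.I_im, mul_zero, mul_one] at this
    linarith
  have hstab : IsUpperHalfPlaneStable gε := isUpperHalfPlaneStable_of_diagonal hgεma hgεs hst
  refine hstab (fun i => ξ i + (ε : ℂ) * Complex.I) (fun i => ?_) ?_
  · simp only [Complex.add_im, Complex.mul_im, Complex.ofReal_re, Complex.ofReal_im, Complex.I_re,
      Complex.I_im, mul_zero, mul_one]
    linarith [hξ i]
  · rw [hgε, eval_affineSubst]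
    have : (fun i => (1 : ℂ) * (ξ i + (ε : ℂ) * Complex.I) + -((ε : ℂ) * Complex.I)) = ξ :=
      funext fun i => by ring
    rw [this, hg0]

/-- GWS for the closed upper half-plane, `MvPolynomial.IsSymmetric` form.
[cite: BorceaBranden2009II, §1 Thm. 1.1 (C the closed upper half-plane)] -/
theorem _root_.MvPolynomial.IsSymmetric.exists_eval_eq_eval_const_of_im_nonneg
    {f : MvPolynomial σ ℂ} (hfs : f.IsSymmetric) (hf : IsMultiAffine f) (ξ : σ → ℂ)
    (hξ : ∀ i, 0 ≤ (ξ i).im) : ∃ ζ : ℂ, 0 ≤ ζ.im ∧ eval ξ f = eval (fun _ : σ => ζ) f :=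
  StablePolynomials.exists_eval_eq_eval_const_of_im_nonneg hf hfs ξ hξ

/-- **Grace–Walsh–Szegő for an arbitrary open half-plane** `C = {z : Im(az + b) > 0}` (`a ≠ 0`):
`f` symmetric multi-affine, `ξ_i ∈ C` ⟹ `f(ξ) = f(ζ,…,ζ)` for some `ζ ∈ C`. Transported from `H`
along `z ↦ az + b` (BB-II Lemma 1.8: the operators `Φ_κ` carry `C`-stable polynomials to `D`-stable
ones and commute with symmetrization). [cite: BorceaBranden2009II, §1 Thm. 1.1 (C an open
half-plane) and Lemma 1.8] -/
theorem exists_eval_eq_eval_const_of_im_affine_pos {f : MvPolynomial σ ℂ} (hf : IsMultiAffine f)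
    (hfs : ∀ e : Equiv.Perm σ, rename (⇑e) f = f) {a : ℂ} (ha : a ≠ 0) (b : ℂ) (ξ : σ → ℂ)
    (hξ : ∀ i, 0 < (a * ξ i + b).im) :
    ∃ ζ : ℂ, 0 < (a * ζ + b).im ∧ eval ξ f = eval (fun _ : σ => ζ) f := by
  -- `F(w) = f(a⁻¹ w - a⁻¹ b)`, so that `F(aξ + b) = f(ξ)`
  obtain ⟨ζ', hζ', hval⟩ := exists_eval_eq_eval_const_of_im_pos (hf.affineSubst a⁻¹ (-(a⁻¹ * b)))
    (fun e => by rw [rename_perm_affineSubst, hfs]) (fun i => a * ξ i + b) hξ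
  refine ⟨a⁻¹ * ζ' + -(a⁻¹ * b), ?_, ?_⟩
  · have : a * (a⁻¹ * ζ' + -(a⁻¹ * b)) + b = ζ' := by field_simp; ring
    rwa [this]
  · rw [eval_affineSubst, eval_affineSubst] at hval
    have hξ' : (fun i => a⁻¹ * (a * ξ i + b) + -(a⁻¹ * b)) = ξ := funext fun i => by
      field_simp
      ring
    rwa [hξ'] at hval

/-- **Grace–Walsh–Szegő for an arbitrary closed half-plane** `C = {z : Im(az + b) ≥ 0}` (`a ≠ 0`).
[cite: BorceaBranden2009II, §1 Thm. 1.1 (C a closed half-plane) and Lemma 1.8] -/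
theorem exists_eval_eq_eval_const_of_im_affine_nonneg {f : MvPolynomial σ ℂ} (hf : IsMultiAffine f)
    (hfs : ∀ e : Equiv.Perm σ, rename (⇑e) f = f) {a : ℂ} (ha : a ≠ 0) (b : ℂ) (ξ : σ → ℂ)
    (hξ : ∀ i, 0 ≤ (a * ξ i + b).im) :
    ∃ ζ : ℂ, 0 ≤ (a * ζ + b).im ∧ eval ξ f = eval (fun _ : σ => ζ) f := by
  obtain ⟨ζ', hζ', hval⟩ := exists_eval_eq_eval_const_of_im_nonneg (hf.affineSubst a⁻¹ (-(a⁻¹ * b)))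
    (fun e => by rw [rename_perm_affineSubst, hfs]) (fun i => a * ξ i + b) hξ
  refine ⟨a⁻¹ * ζ' + -(a⁻¹ * b), ?_, ?_⟩
  · have : a * (a⁻¹ * ζ' + -(a⁻¹ * b)) + b = ζ' := by field_simp; ring
    rwa [this]
  · rw [eval_affineSubst, eval_affineSubst] at hval
    have hξ' : (fun i => a⁻¹ * (a * ξ i + b) + -(a⁻¹ * b)) = ξ := funext fun i => by
      field_simp
      ring
    rwa [hξ'] at hval

/-- **GWS for the open lower half-plane** `{Im z < 0}` (the half-plane relevant to generating
polynomials with roots "above"): `a = -1`, `b = 0`. [cite: BorceaBranden2009II, §1 Thm. 1.1 (C an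
open half-plane)] -/
theorem exists_eval_eq_eval_const_of_im_neg {f : MvPolynomial σ ℂ} (hf : IsMultiAffine f)
    (hfs : ∀ e : Equiv.Perm σ, rename (⇑e) f = f) (ξ : σ → ℂ) (hξ : ∀ i, (ξ i).im < 0) :
    ∃ ζ : ℂ, ζ.im < 0 ∧ eval ξ f = eval (fun _ : σ => ζ) f := by
  obtain ⟨ζ, hζ, h⟩ := exists_eval_eq_eval_const_of_im_affine_pos hf hfs (a := -1)
    (neg_ne_zero.2 one_ne_zero) 0 ξ (fun i => by simpa using hξ i)
  exact ⟨ζ, by simpa using hζ, h⟩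

/-- **GWS for the open right half-plane** `{Re z > 0}` (Hurwitz stability): `a = i`, `b = 0`, since
`Im(iz) = Re z`. [cite: BorceaBranden2009II, §1 Thm. 1.1 (C an open half-plane)] -/
theorem exists_eval_eq_eval_const_of_re_pos {f : MvPolynomial σ ℂ} (hf : IsMultiAffine f)
    (hfs : ∀ e : Equiv.Perm σ, rename (⇑e) f = f) (ξ : σ → ℂ) (hξ : ∀ i, 0 < (ξ i).re) :
    ∃ ζ : ℂ, 0 < ζ.re ∧ eval ξ f = eval (fun _ : σ => ζ) f := by
  obtain ⟨ζ, hζ, h⟩ := exists_eval_eq_eval_const_of_im_affine_pos hf hfs (a := Complex.I)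
    Complex.I_ne_zero 0 ξ (fun i => by simpa using hξ i)
  exact ⟨ζ, by simpa using hζ, h⟩

end HalfPlanes

end Literature.Combinatorics.StablePolynomials

end
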